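import Literature.MathematicalPhysics.QuantumFieldTheory.Balaban1983to89.B9Eq360DeltaPrimeAY
import Literature.MathematicalPhysics.QuantumFieldTheory.Balaban1983to89.B9CubeCutoffNearH

/-!
# `Balaban1983to89.B9Cor36CutoffField337` — [Balaban1985BackgroundPropagators] COROLLARY 3.6 p. 408, THE STEP «U′ = U^u = e^{iηA} … satisfies (3.37)
# for the sequence {Ω′_j} with U = 1 and α₁ = O(1)Mα₀» FOR A CUT-OFF EXPONENT FIELD `Ã = χ̃·A`: a smooth plateau cut-off `χ̃` on def-Y's torus
# carrier (§1), and the five blockwise (3.37)-readings of `B9Thm34SectBUniformR1.thm34_Gp_uniform` at the base `U = 1` for `χ̃·A` from the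
# single-scale (3.35) bounds of `A` on a cube (§2–§3) — sub-row G-B9-LETTERS, module M5.1b-G′ (site sector), FILE 3 of seat p33's plan

statement-level skeleton of published theorems with citation tags; proofs where landed; nothing here is a claim about the Yang–Mills mass gap

CITATION HEADER (lean-in-tree rule).  B9 = T. Bałaban, *Propagators for lattice gauge theories in a background field*, Commun. Math. Phys. **99** (1985)
389–434 [Balaban1985BackgroundPropagators] (held `paper:balaban1985-cmp99-background-propagators`; journal page = PDF page + 388).  Cor. 3.6 p. 408 [PDF 20]
l. 3–9: «Applying the gauge transformation u we get U′ = U^u = e^{iηA} with A satisfying the inequalities in (3.35) for j = k. This implies that U′ satisfies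
(3.37) for the sequence {Ω′_j} with U = 1 and α₁ = O(1)Mα₀, hence the operators G′(U′), … , satisfy the inequalities (3.42)–(3.49)»; (3.35) p. 396 [PDF 8]
«|A| < α₀M(Lʲη)⁻¹, |∇^η A| < α₀M(Lʲη)⁻² on □̃»; (3.37) p. 396 «|A′| < α₁(Lʲη)⁻¹, |∇^η_U A′| < α₁(Lʲη)⁻² on Ω_j, j = 0, …, k»; Sect. C p. 408 l. 36–44,
p. 409 l. 1–5 (the cube sequence {Ω_n(□)} and «the sequence {Ω_n(□)} satisfies the assumptions of Corollary 3.6»).  [4] = [Balaban1984PropagatorsII]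
(2.36) p. 229, [4-I] = [Balaban1984PropagatorsI] (1.118) p. 36 (the C₀^∞ plateau profile).  Rows B9.Cor3.6 × B9.Eq3.37 × B9.Eq3.35 (cells only; no
row head changes).

WHY THIS FILE (cell lit-balaban, sub-row G-B9-LETTERS, module M5.1b-G′ booked to seat p33 by the map owner r06 g67, `lit-balaban-r06/B9-LETTERS-MAP.md`
§8; design memo `lit-balaban-p33/COR35GP-STATEMENTS-p33.md` v1 §1).  The consumer of record, p21's M5.5 FILE 6
`B9Thm37GpTorusRegularFinal.eBlock_kernelFamilySInv_Gp_of_localInverse`, displays per cover cube `c` a letter `O_c` with two local-inverse laws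
(`hloc`, `hlocT` — supplied by FILE 2 `B9Cor36GpCubeLocLetter` for the U-constant letter `locLetterY i c parS u_c χ_c Ṽ_c`) and the entry bounds
`hE` (Sect. B's Theorem 3.4 at the base `1` for the cube letters, FILE 1 `B9Eq360DeltaPrimeACubeY` + `thm34_Gp_uniform`).  Under ruling (R) the
cube letter reads its configuration on the WHOLE torus, so the (3.37)-input of `thm34_Gp_uniform` must hold GLOBALLY; print's `U^u = e^{iηA}` holds
on the datum cube only.  The (R)-design term is the OUTER CUT-OFF: `Ṽ_c := e^{iη χ̃_c A}` with a smooth plateau cut-off `χ̃_c` (`= 1` near the cube,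
`= 0` off the datum cube, `|∂χ̃_c| ≲ (LS_j)⁻¹`), so that `Ã := χ̃_c·A` is a GLOBAL exponent field obeying (3.37) around `1` with `α₁ = O(1)·C`
(Leibniz: `∇^η(χ̃A) = χ̃(·+e_μ)∇^ηA + (∇^ηχ̃)A`, and `|∇^ηχ̃|·|A| ≲ (LS_jη)⁻¹·C(L^{j₀}η)⁻¹ ≤ C(L^{j₀}η)⁻²`).  THIS FILE supplies (§1) the plateau
cut-off on def-Y's carrier with its plateau ∕ support ∕ one-step Lipschitz facts, and (§2–§3) the five reading hypotheses of `thm34_Gp_uniform`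
(`hA`, `hAτB`, `h337F`, `h337B`, `h337Bτ`) for `chartA i (χ̃·A)` at the base `1`, from single-scale bounds of `A` on a set `Q` carrying the
support of `χ̃` and its backward translates — first uniformly (§2, any carrier), then blockwise against any length function `len ≤ Λ·ξ` (the
cube levels are `≤ j_c + 1`, `B9CubeSequence408.lev_cubeFam_le_succ`, so `Λ ∈ {L, L²}`).  FILE 4 (`B9Cor36CubeCutoffs`) instantiates `χ̃ := bumpY i (ctrC c) (4LS_j)`
and discharges FILE 2's geometric hypotheses.

WHAT IS PROVED (2 `def`s with bodies — `bumpY`, `cutA` — and 1 `abbrev` `cutFldY`; 0 sorry; 0 new named facts; standard axioms):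
* §1 `bumpY i m ρ z = Π_ν θ(dist(z_ν − m_ν, N_νℤ)/ρ)` (`θ = B4PartitionUnity22.thetaProf`, `= 1` on `|t| ≤ ¾`, `= 0` off `(−⅞, ⅞)`): `bumpY_nonneg`,
  `bumpY_le_one`, ★`bumpY_eq_one` (plateau: all coordinates within `¾ρ`), ★`bumpY_eq_zero`∕`lt_of_bumpY_ne_zero` (support: all coordinates `< ⅞ρ`),
  ★`abs_bumpY_tshift_sub_le` (`|χ(z + t) − χ(z)| ≤ (D₁θ/ρ)·Σ_ν|t_ν|` on the torus), `abs_bumpY_shiftY_sub_le`, `abs_bumpY_shiftY_symm_sub_le` (one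
  lattice step costs `≤ D₁θ/ρ`);
* §2 (ANY finite carrier `S`, shifts `T`, base `1`): `cutA χ A κ x = χ(x)·A_κ(x)`; `covD_one_apply`, `covDstar_one_apply`, `tauB_one_apply`; ★★`norm_cutA_le`,
  ★★`norm_covD_cutA_le` (`‖η⁻¹∇_1(χA)‖ ≤ b + |η|⁻¹·g_χ·a` from `|χ| ≤ 1`, `|χ(x+e_μ) − χ(x)| ≤ g_χ`, `‖A‖ ≤ a`, `‖η⁻¹∇_1A‖ ≤ b` on `Q ⊇ supp χ ∪ (supp χ − e_μ)`),
  `norm_covDstar_cutA_le`, `norm_covDstar_tauB_cutA_le`, `norm_tauB_cutA_le`; ★★`readings337_cutA` (the five `thm34_Gp_uniform` readings blockwise against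
  any `len` with `0 < len ≤ Λξ`, `α₁ := K·Λ²`, `K ≥ max(a·ξ, (b + |η|⁻¹g_χa)·ξ²)`);
* §3 (def-Y's chart): `cutFldY i χ A` (the torus-side field `χ(chart x)·A_κ(x)`), `chartA_cutFldY`, `UboxY_one`, ★`covD_one_chartA` (the flat derivative
  commutes with the chart, via def-Y's `Node00.boxEquiv_symm_shiftY`), ★★`readings337_chartA_cutFldY` (§2 fed with torus-side (3.35)-type bounds on `Q`).

PROOF.  Ours, elementary (Leibniz rule for a scalar cut-off; product telescoping `|Πa − Πb| ≤ Σ|a − b|` on `[0,1]`; `dist(·, Nℤ)` is 1-Lipschitz).  Print has no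
cut-off at this point (its cube letters live on `Ω₀(□) ⊂ □̃⁵` with Dirichlet rows); the cut-off is the (R)-design's replacement, declared in FILE 2's header.

HONEST SCOPE / NOT CLAIMED.  Bookkeeping inequalities only; no statement of [B9] is asserted as proved here; the constants (`D₁θ`, `K`) are not optimised and
not print's; `Q`, `χ`, `len`, `Λ` are parameters (FILE 4 fixes them for the cube of p. 408).  Nothing on `d = 4`, the continuum, reflection positivity or the
mass gap; NOT a node discharge; no row head changes.

RELATED IN THE TREE, NOT DUPLICATED: the partition cut-off `B6Partition118KLevelTorus.hT` (fixed radius `S_j`, normalised — not a plateau function of free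
radius) and its Lipschitz bound `B6Partition118KLevelTorusBinders.abs_hT_sub_le_near`; p21's `B9Cor36GaugeReductionCube.Small337OnCube` (the (3.37) bounds ON
the cube, no cut-off); `B9Eq335RegularityClasses.Reg335Cube` (the datum; consumed in FILE 4, not here).
-/

noncomputable section

namespace Literature.MathematicalPhysics.QuantumFieldTheory.Balaban1983to89.B9Cor36CutoffField337

open Literature.MathematicalPhysics.QuantumFieldTheory.Balaban1983to89
open Literature.MathematicalPhysics.QuantumFieldTheory.Balaban1983to89.B4PartitionUnity22 (thetaProf thetaProf_nonneg thetaProf_le_one thetaProf_eq_one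
  thetaProf_eq_zero contDiff_thetaProf hasCompactSupport_thetaProf D1 D1_nonneg abs_sub_le_D1)
open Literature.MathematicalPhysics.QuantumFieldTheory.Balaban1983to89.B6Partition118KLevelTorus (circR circR_nonneg circR_add_mul)
open Literature.MathematicalPhysics.QuantumFieldTheory.Balaban1983to89.B9CubeCutoffNearH (circR_add_le')
open Literature.MathematicalPhysics.QuantumFieldTheory.Balaban1983to89.B6MultiLevelTorusOperator (tshift tshift_val_eq_translate tshift_symm_apply unitVec
  one_le_of_mem)
open Literature.MathematicalPhysics.QuantumFieldTheory.Balaban1983to89.B4Reflection242 (boxDom)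
open Literature.MathematicalPhysics.QuantumFieldTheory.Balaban1983to89.B9Eq39Adjoint (R R_one covD covDstar)
open Literature.MathematicalPhysics.QuantumFieldTheory.Balaban1983to89.B9Eq352DivForm (tauB)
open Literature.MathematicalPhysics.QuantumFieldTheory.Balaban1983to89.B9Eq360DeltaPrimeAY (chartA chartA_apply AfldY)
open Literature.MathematicalPhysics.QuantumFieldTheory.Balaban1983to89.B6KLevelCensusIndexV1 (KIdx)
open Literature.MathematicalPhysics.QuantumFieldTheory.Balaban1983to89.B6GlobalChartV1 (PV boxEquiv boxEquiv_apply)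
open Literature.MathematicalPhysics.QuantumFieldTheory.Balaban1983to89.B9BackgroundsKLevelV1 (shiftsV1)
open Literature.MathematicalPhysics.QuantumFieldTheory.Balaban1983to89.Node00 (SiteY toKT shiftY UboxY boxEquiv_symm_shiftY)

variable {d ℓ : ℕ} {hd : 1 ≤ d + 1} {hL : Odd (ℓ + 1) ∧ 1 < ℓ + 1} {b₀ b₁ : ℝ}

/-! ## §0  Two folklore inequalities -/

/-- `|∏ aₗ − ∏ bₗ| ≤ ∑ |aₗ − bₗ|` for factors in `[0, 1]`. [folklore] -/
private theorem abs_prod_sub_prod_le_sum {ι : Type*} (s : Finset ι) {a b : ι → ℝ}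
    (ha0 : ∀ i ∈ s, 0 ≤ a i) (ha1 : ∀ i ∈ s, a i ≤ 1) (hb0 : ∀ i ∈ s, 0 ≤ b i) (hb1 : ∀ i ∈ s, b i ≤ 1) :
    |∏ i ∈ s, a i - ∏ i ∈ s, b i| ≤ ∑ i ∈ s, |a i - b i| := by
  classical
  induction s using Finset.induction_on with
  | empty => simp
  | insert j s hj ih =>
    rw [Finset.prod_insert hj, Finset.prod_insert hj, Finset.sum_insert hj]
    have hm : ∀ {c : ι → ℝ}, (∀ i ∈ insert j s, 0 ≤ c i) → ∀ i ∈ s, 0 ≤ c i := fun h i hi => h i (Finset.mem_insert_of_mem hi)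
    have hm' : ∀ {c : ι → ℝ}, (∀ i ∈ insert j s, c i ≤ 1) → ∀ i ∈ s, c i ≤ 1 := fun h i hi => h i (Finset.mem_insert_of_mem hi)
    have ih' := ih (hm ha0) (hm' ha1) (hm hb0) (hm' hb1)
    have hPa0 : 0 ≤ ∏ i ∈ s, a i := Finset.prod_nonneg (hm ha0)
    have hPa1 : ∏ i ∈ s, a i ≤ 1 := Finset.prod_le_one (hm ha0) (hm' ha1)
    have hPb0 : 0 ≤ ∏ i ∈ s, b i := Finset.prod_nonneg (hm hb0)
    have hPb1 : ∏ i ∈ s, b i ≤ 1 := Finset.prod_le_one (hm hb0) (hm' hb1)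
    have hbj0 : 0 ≤ b j := hb0 j (Finset.mem_insert_self j s)
    have hbj1 : b j ≤ 1 := hb1 j (Finset.mem_insert_self j s)
    have e : a j * ∏ i ∈ s, a i - b j * ∏ i ∈ s, b i = (a j - b j) * ∏ i ∈ s, a i + b j * (∏ i ∈ s, a i - ∏ i ∈ s, b i) := by ring
    rw [e]
    refine (abs_add_le _ _).trans ?_
    rw [abs_mul, abs_mul, abs_of_nonneg hPa0, abs_of_nonneg hbj0]
    have h1 : |a j - b j| * ∏ i ∈ s, a i ≤ |a j - b j| := mul_le_of_le_one_right (abs_nonneg _) hPa1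
    have h2 : b j * |∏ i ∈ s, a i - ∏ i ∈ s, b i| ≤ ∑ i ∈ s, |a i - b i| :=
      (mul_le_of_le_one_left (abs_nonneg _) hbj1).trans ih'
    linarith

/-- the torus distance `dist(·, Nℤ)` is 1-Lipschitz: `|dist(t + u) − dist(t)| ≤ |u|`. [folklore] [cite: Balaban1984PropagatorsII, (2.2) p.224 (torus distance), bookkeeping] -/
theorem abs_circR_add_sub_le (N : ℕ) (t u : ℝ) : |circR N (t + u) - circR N t| ≤ |u| := by
  rw [abs_sub_le_iff]
  constructor
  · linarith [circR_add_le' N t u]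
  · have h := circR_add_le' N (t + u) (-u)
    rw [add_neg_cancel_right, abs_neg] at h
    linarith

/-! ## §1  The plateau cut-off `bumpY` on def-Y's torus carrier -/

section Bump

variable (i : KIdx d ℓ hd hL b₀ b₁)

/-- **THE PLATEAU CUT-OFF OF RADIUS `ρ` ABOUT `m` ON def-Y's TORUS CARRIER**: `χ(z) = Π_ν θ(dist(z_ν − m_ν, N_νℤ)/ρ)` with the C₀^∞ plateau profile
`θ = thetaProf` (`= 1` on `|t| ≤ ¾`, `= 0` off `(−⅞, ⅞)`) — equal to `1` where every coordinate is within `¾ρ` of `m` (torus distance), `0` where some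
coordinate is `≥ ⅞ρ` away; one lattice step changes it by at most `D₁θ/ρ`.  (The (R)-design's outer cut-off `χ̃_□`; print's nearest object is the
rescaled (1.118) bump of [4] (2.36).) [cite: Balaban1984PropagatorsII, (2.36) p.229; Balaban1984PropagatorsI, (1.118) p.36; Balaban1985BackgroundPropagators, Cor. 3.6 p.408] -/
def bumpY (m : Fin (d + 1) → ℝ) (ρ : ℝ) (z : SiteY i) : ℝ :=
  ∏ ν, thetaProf (circR ((toKT i).NB ν) ((z.1 ν : ℝ) - m ν) / ρ)

/-- unfolding `bumpY`. [cite: Balaban1984PropagatorsII, (2.36) p.229, bookkeeping] -/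
theorem bumpY_apply (m : Fin (d + 1) → ℝ) (ρ : ℝ) (z : SiteY i) :
    bumpY i m ρ z = ∏ ν, thetaProf (circR ((toKT i).NB ν) ((z.1 ν : ℝ) - m ν) / ρ) := rfl

/-- `0 ≤ χ`. [cite: Balaban1984PropagatorsI, (1.118) p.36, bookkeeping] -/
theorem bumpY_nonneg (m : Fin (d + 1) → ℝ) (ρ : ℝ) (z : SiteY i) : 0 ≤ bumpY i m ρ z :=
  Finset.prod_nonneg fun _ _ => thetaProf_nonneg _

/-- `χ ≤ 1`. [cite: Balaban1984PropagatorsI, (1.118) p.36, bookkeeping] -/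
theorem bumpY_le_one (m : Fin (d + 1) → ℝ) (ρ : ℝ) (z : SiteY i) : bumpY i m ρ z ≤ 1 :=
  Finset.prod_le_one (fun _ _ => thetaProf_nonneg _) fun _ _ => thetaProf_le_one _

/-- `|χ| ≤ 1`. [cite: Balaban1984PropagatorsI, (1.118) p.36, bookkeeping] -/
theorem abs_bumpY_le_one (m : Fin (d + 1) → ℝ) (ρ : ℝ) (z : SiteY i) : |bumpY i m ρ z| ≤ 1 := by
  rw [abs_of_nonneg (bumpY_nonneg i m ρ z)]; exact bumpY_le_one i m ρ z

/-- ★ **PLATEAU**: if every coordinate of `z` is within torus distance `¾ρ` of `m`, then `χ(z) = 1`. [cite: Balaban1984PropagatorsI, (1.118) p.36 («h(t) = 1 for …»), bookkeeping] -/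
theorem bumpY_eq_one {m : Fin (d + 1) → ℝ} {ρ : ℝ} (hρ : 0 < ρ) {z : SiteY i}
    (h : ∀ ν, circR ((toKT i).NB ν) ((z.1 ν : ℝ) - m ν) ≤ 3 / 4 * ρ) : bumpY i m ρ z = 1 := by
  refine Finset.prod_eq_one fun ν _ => thetaProf_eq_one ?_
  rw [abs_div, abs_of_pos hρ, abs_of_nonneg (circR_nonneg _ _), div_le_iff₀ hρ]
  exact h ν

/-- ★ **SUPPORT**: if some coordinate of `z` is at torus distance `≥ ⅞ρ` from `m`, then `χ(z) = 0`. [cite: Balaban1984PropagatorsI, (1.118) p.36 («h ∈ C₀^∞»), bookkeeping] -/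
theorem bumpY_eq_zero {m : Fin (d + 1) → ℝ} {ρ : ℝ} (hρ : 0 < ρ) {z : SiteY i} {ν : Fin (d + 1)}
    (h : 7 / 8 * ρ ≤ circR ((toKT i).NB ν) ((z.1 ν : ℝ) - m ν)) : bumpY i m ρ z = 0 := by
  refine Finset.prod_eq_zero (Finset.mem_univ ν) (thetaProf_eq_zero ?_)
  rw [abs_div, abs_of_pos hρ, abs_of_nonneg (circR_nonneg _ _), le_div_iff₀ hρ]
  exact h

/-- where `χ ≠ 0`, every coordinate is within torus distance `< ⅞ρ` of `m`. [cite: Balaban1984PropagatorsI, (1.118) p.36, bookkeeping] -/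
theorem lt_of_bumpY_ne_zero {m : Fin (d + 1) → ℝ} {ρ : ℝ} (hρ : 0 < ρ) {z : SiteY i} (h : bumpY i m ρ z ≠ 0) (ν : Fin (d + 1)) :
    circR ((toKT i).NB ν) ((z.1 ν : ℝ) - m ν) < 7 / 8 * ρ := by
  by_contra hc
  exact h (bumpY_eq_zero i hρ (not_lt.1 hc))

/-- ★ **ONE-STEP LIPSCHITZ ON THE TORUS**: a translation by `t` changes `χ` by at most `(D₁θ/ρ)·Σ_ν |t_ν|` (each factor is `D₁θ/ρ`-Lipschitz in the torus
distance, which moves by `≤ |t_ν|`; factors lie in `[0, 1]`). [cite: Balaban1984PropagatorsII, p.247 («|∂h_□| ≤ O(1)(MLʲη)⁻¹»), (2.36) p.229; Balaban1984PropagatorsI, (1.118) p.36] -/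
theorem abs_bumpY_tshift_sub_le (m : Fin (d + 1) → ℝ) {ρ : ℝ} (hρ : 0 < ρ) (t : Fin (d + 1) → ℤ) (z : SiteY i) :
    |bumpY i m ρ (tshift (toKT i).NB t z) - bumpY i m ρ z| ≤ D1 thetaProf / ρ * ∑ ν, |(t ν : ℝ)| := by
  have hN : ∀ ν, 1 ≤ (toKT i).NB ν := one_le_of_mem z.2
  obtain ⟨mm, hmm⟩ := tshift_val_eq_translate (toKT i).NB t z
  rw [bumpY_apply, bumpY_apply, Finset.mul_sum]
  refine (abs_prod_sub_prod_le_sum _ (fun _ _ => thetaProf_nonneg _) (fun _ _ => thetaProf_le_one _) (fun _ _ => thetaProf_nonneg _)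
    fun _ _ => thetaProf_le_one _).trans (Finset.sum_le_sum fun ν _ => ?_)
  have hcoord : ((tshift (toKT i).NB t z).1 ν : ℝ) - m ν = ((z.1 ν : ℝ) - m ν + t ν) + ((toKT i).NB ν : ℝ) * (mm ν : ℤ) := by
    rw [hmm]; simp only [B4TorusKernel.MultiPeriod.translate, Pi.add_apply]; push_cast; ring
  rw [hcoord, circR_add_mul (hN ν)]
  refine (abs_sub_le_D1 contDiff_thetaProf hasCompactSupport_thetaProf _ _).trans ?_
  rw [← sub_div, abs_div, abs_of_pos hρ]
  have h1 := abs_circR_add_sub_le ((toKT i).NB ν) ((z.1 ν : ℝ) - m ν) (t ν)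
  have hD := D1_nonneg contDiff_thetaProf hasCompactSupport_thetaProf
  calc D1 thetaProf * (|circR ((toKT i).NB ν) ((z.1 ν : ℝ) - m ν + t ν) - circR ((toKT i).NB ν) ((z.1 ν : ℝ) - m ν)| / ρ)
      ≤ D1 thetaProf * (|(t ν : ℝ)| / ρ) := mul_le_mul_of_nonneg_left (div_le_div_of_nonneg_right h1 hρ.le) hD
    _ = D1 thetaProf / ρ * |(t ν : ℝ)| := by ring

/-- `Σ_ν |(±e_μ)_ν| = 1`. [folklore] -/
private theorem sum_abs_unitVec (μ : Fin (d + 1)) (s : ℤ) (hs : s = 1 ∨ s = -1) : ∑ ν, |(((s • unitVec μ) ν : ℤ) : ℝ)| = 1 := by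
  have e : ∀ ν, |(((s • unitVec μ) ν : ℤ) : ℝ)| = if ν = μ then 1 else 0 := by
    intro ν
    simp only [unitVec, Pi.smul_apply, Pi.single_apply, smul_eq_mul]
    split_ifs with h
    · rcases hs with hs | hs <;> simp [hs]
    · simp
  simp_rw [e]
  simp

/-- one forward lattice step costs `χ` at most `D₁θ/ρ`. [cite: Balaban1984PropagatorsII, p.247 («|∂h_□| ≤ O(1)(MLʲη)⁻¹»)] -/
theorem abs_bumpY_shiftY_sub_le (m : Fin (d + 1) → ℝ) {ρ : ℝ} (hρ : 0 < ρ) (μ : Fin (d + 1)) (z : SiteY i) :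
    |bumpY i m ρ (shiftY i μ z) - bumpY i m ρ z| ≤ D1 thetaProf / ρ := by
  have e : shiftY i μ z = tshift (toKT i).NB ((1 : ℤ) • unitVec μ) z := by rw [one_smul]; rfl
  have h := abs_bumpY_tshift_sub_le i m hρ ((1 : ℤ) • unitVec μ) z
  rwa [← e, sum_abs_unitVec μ 1 (Or.inl rfl), mul_one] at h

/-- one backward lattice step costs `χ` at most `D₁θ/ρ`. [cite: Balaban1984PropagatorsII, p.247 («|∂h_□| ≤ O(1)(MLʲη)⁻¹»)] -/
theorem abs_bumpY_shiftY_symm_sub_le (m : Fin (d + 1) → ℝ) {ρ : ℝ} (hρ : 0 < ρ) (μ : Fin (d + 1)) (z : SiteY i) :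
    |bumpY i m ρ ((shiftY i μ).symm z) - bumpY i m ρ z| ≤ D1 thetaProf / ρ := by
  have e : (shiftY i μ).symm z = tshift (toKT i).NB ((-1 : ℤ) • unitVec μ) z := by
    rw [neg_one_smul]; exact tshift_symm_apply _ _ _
  have h := abs_bumpY_tshift_sub_le i m hρ ((-1 : ℤ) • unitVec μ) z
  rwa [← e, sum_abs_unitVec μ (-1) (Or.inr rfl), mul_one] at h

end Bump

/-! ## §2  The cut-off exponent field `χ·A` at the base `U = 1` on ANY carrier: the five (3.37)-readings of `thm34_Gp_uniform` -/

section Generic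

variable {𝔸 : Type*} [NormedRing 𝔸]
variable {S : Type*} {ι : Type*} (T : ι → Equiv.Perm S)

/-- (3.3) at the base `U = 1`: `(D_{1,μ}f)(x) = f(x + e_μ) − f(x)`. [cite: Balaban1985BackgroundPropagators, (3.3) p.390, (3.37) p.396 («with U = 1», p.408)] -/
theorem covD_one_apply (μ : ι) (f : S → 𝔸) (x : S) : covD T (fun _ _ => (1 : 𝔸ˣ)) μ f x = f (T μ x) - f x := by
  rw [covD, R_one]

/-- (3.8) at the base `U = 1`: `(D*_{1,μ}f)(x) = f(x − e_μ) − f(x)`. [cite: Balaban1985BackgroundPropagators, (3.8) p.392] -/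
theorem covDstar_one_apply (μ : ι) (f : S → 𝔸) (x : S) : covDstar T (fun _ _ => (1 : 𝔸ˣ)) μ f x = f ((T μ).symm x) - f x := by
  rw [covDstar, inv_one, R_one]

/-- the backward transported shift at the base `U = 1`: `(τ*_μ f)(x) = f(x − e_μ)`. [cite: Balaban1985BackgroundPropagators, (3.50) p.400] -/
theorem tauB_one_apply (μ : ι) (f : S → 𝔸) (x : S) : tauB T (fun _ _ => (1 : 𝔸ˣ)) μ f x = f ((T μ).symm x) := by
  rw [tauB, inv_one, R_one]

/-- `D*_{1,ν}f(x) = −D_{1,ν}f(x − e_ν)`. [cite: Balaban1985BackgroundPropagators, (3.8) p.392, bookkeeping] -/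
theorem covDstar_one_eq_neg_covD (ν : ι) (f : S → 𝔸) (x : S) :
    covDstar T (fun _ _ => (1 : 𝔸ˣ)) ν f x = -covD T (fun _ _ => (1 : 𝔸ˣ)) ν f ((T ν).symm x) := by
  rw [covDstar_one_apply, covD_one_apply, Equiv.apply_symm_apply, neg_sub]

variable [NormedAlgebra ℂ 𝔸]

/-- the cut-off exponent field `(χ·A)_κ(x) = χ(x)·A_κ(x)` (real scalar cut-off at the initial point of the bond).
[cite: Balaban1985BackgroundPropagators, Cor. 3.6 p.408 («U′ = U^u = e^{iηA}»), (3.37) p.396] -/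
def cutA (χ : S → ℝ) (A : ι → S → 𝔸) : ι → S → 𝔸 := fun κ x => ((χ x : ℝ) : ℂ) • A κ x

/-- unfolding `cutA`. [cite: Balaban1985BackgroundPropagators, (3.37) p.396, bookkeeping] -/
@[simp] theorem cutA_apply (χ : S → ℝ) (A : ι → S → 𝔸) (κ : ι) (x : S) : cutA χ A κ x = ((χ x : ℝ) : ℂ) • A κ x := rfl

/-- the norm of a real-scalar multiple. [folklore] -/
private theorem norm_real_smul (r : ℝ) (a : 𝔸) : ‖((r : ℂ) • a)‖ = |r| * ‖a‖ := by
  rw [norm_smul, Complex.norm_real, Real.norm_eq_abs]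

variable {T}

/-- ★★ **`|χ·A| ≤ a`**: from `|χ| ≤ 1` and `‖A_κ‖ ≤ a` on a set `Q ⊇ supp χ`. [cite: Balaban1985BackgroundPropagators, (3.37) p.396 («|A′| < α₁(Lʲη)⁻¹»), Cor. 3.6 p.408] -/
theorem norm_cutA_le {χ : S → ℝ} {A : ι → S → 𝔸} {Q : Set S} {a : ℝ} (ha : 0 ≤ a) (hχ1 : ∀ x, |χ x| ≤ 1)
    (hQ0 : ∀ x, χ x ≠ 0 → x ∈ Q) (hA : ∀ κ, ∀ x ∈ Q, ‖A κ x‖ ≤ a) (κ : ι) (x : S) : ‖cutA χ A κ x‖ ≤ a := by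
  rw [cutA_apply, norm_real_smul]
  by_cases hx : χ x = 0
  · rw [hx, abs_zero, zero_mul]; exact ha
  · exact (mul_le_mul (hχ1 x) (hA κ x (hQ0 x hx)) (norm_nonneg _) zero_le_one).trans (one_mul a).le

/-- ★★ **`|η⁻¹∇_1(χ·A)| ≤ b + |η|⁻¹·g_χ·a`** (LEIBNIZ): `η⁻¹D_{1,μ}(χA_ν)(x) = χ(x+e_μ)·η⁻¹D_{1,μ}A_ν(x) + η⁻¹(χ(x+e_μ) − χ(x))·A_ν(x)`, with `|χ| ≤ 1`,
`|χ(x+e_μ) − χ(x)| ≤ g_χ`, and `‖A‖ ≤ a`, `‖η⁻¹D_{1,μ}A_ν‖ ≤ b` on a set `Q` containing `supp χ` and its backward translates `supp χ − e_μ` (off `Q` both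
terms vanish). [cite: Balaban1985BackgroundPropagators, (3.37) p.396 («|∇^η_U A′| < α₁(Lʲη)⁻²»), Cor. 3.6 p.408, (3.3) p.390] -/
theorem norm_covD_cutA_le {χ : S → ℝ} {A : ι → S → 𝔸} {Q : Set S} {a b g η : ℝ} (ha : 0 ≤ a) (hb : 0 ≤ b) (hg : 0 ≤ g)
    (hχ1 : ∀ x, |χ x| ≤ 1) (hχg : ∀ μ x, |χ (T μ x) - χ x| ≤ g) (hQ0 : ∀ x, χ x ≠ 0 → x ∈ Q) (hQ1 : ∀ μ x, χ (T μ x) ≠ 0 → x ∈ Q)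
    (hA : ∀ κ, ∀ x ∈ Q, ‖A κ x‖ ≤ a) (hdA : ∀ μ ν, ∀ x ∈ Q, ‖((η : ℂ)⁻¹) • covD T (fun _ _ => (1 : 𝔸ˣ)) μ (A ν) x‖ ≤ b) (μ ν : ι) (x : S) :
    ‖((η : ℂ)⁻¹) • covD T (fun _ _ => (1 : 𝔸ˣ)) μ (cutA χ A ν) x‖ ≤ b + |η|⁻¹ * g * a := by
  have e : covD T (fun _ _ => (1 : 𝔸ˣ)) μ (cutA χ A ν) x =
      ((χ (T μ x) : ℝ) : ℂ) • covD T (fun _ _ => (1 : 𝔸ˣ)) μ (A ν) x + (((χ (T μ x) - χ x : ℝ)) : ℂ) • A ν x := by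
    rw [covD_one_apply, covD_one_apply, cutA_apply, cutA_apply, smul_sub, Complex.ofReal_sub, sub_smul]
    abel
  by_cases hx : x ∈ Q
  · rw [e, smul_add, smul_comm, smul_comm ((η : ℂ)⁻¹) (((χ (T μ x) - χ x : ℝ)) : ℂ)]
    refine (norm_add_le _ _).trans (add_le_add ?_ ?_)
    · rw [norm_real_smul]
      exact (mul_le_mul (hχ1 _) (hdA μ ν x hx) (norm_nonneg _) zero_le_one).trans (one_mul b).le
    · rw [norm_real_smul, norm_smul, norm_inv, Complex.norm_real, Real.norm_eq_abs, ← mul_assoc, mul_comm |χ (T μ x) - χ x|]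
      exact mul_le_mul (mul_le_mul_of_nonneg_left (hχg μ x) (inv_nonneg.2 (abs_nonneg η))) (hA ν x hx) (norm_nonneg _)
        (mul_nonneg (inv_nonneg.2 (abs_nonneg η)) hg)
  · have h0 : χ x = 0 := by by_contra h; exact hx (hQ0 x h)
    have h1 : χ (T μ x) = 0 := by by_contra h; exact hx (hQ1 μ x h)
    rw [e, h0, h1, sub_zero, Complex.ofReal_zero, zero_smul, zero_smul, add_zero, smul_zero, norm_zero]
    positivity

/-- `|η⁻¹D*_1(χ·A)| ≤ b + |η|⁻¹·g_χ·a` (the backward derivative is minus the forward one at `x − e_ν`). [cite: Balaban1985BackgroundPropagators, (3.37) p.396, (3.8) p.392, Cor. 3.6 p.408] -/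
theorem norm_covDstar_cutA_le {χ : S → ℝ} {A : ι → S → 𝔸} {Q : Set S} {a b g η : ℝ} (ha : 0 ≤ a) (hb : 0 ≤ b) (hg : 0 ≤ g)
    (hχ1 : ∀ x, |χ x| ≤ 1) (hχg : ∀ μ x, |χ (T μ x) - χ x| ≤ g) (hQ0 : ∀ x, χ x ≠ 0 → x ∈ Q) (hQ1 : ∀ μ x, χ (T μ x) ≠ 0 → x ∈ Q)
    (hA : ∀ κ, ∀ x ∈ Q, ‖A κ x‖ ≤ a) (hdA : ∀ μ ν, ∀ x ∈ Q, ‖((η : ℂ)⁻¹) • covD T (fun _ _ => (1 : 𝔸ˣ)) μ (A ν) x‖ ≤ b) (ν κ : ι) (x : S) :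
    ‖((η : ℂ)⁻¹) • covDstar T (fun _ _ => (1 : 𝔸ˣ)) ν (cutA χ A κ) x‖ ≤ b + |η|⁻¹ * g * a := by
  rw [covDstar_one_eq_neg_covD, smul_neg, norm_neg]
  exact norm_covD_cutA_le ha hb hg hχ1 hχg hQ0 hQ1 hA hdA ν κ _

/-- `|η⁻¹D*_{1,μ}τ*_μ(χ·A)_μ| ≤ b + |η|⁻¹·g_χ·a` (at the base `1`, `D*_μτ*_μ f(x) = −D_μ f(x − 2e_μ)`). [cite: Balaban1985BackgroundPropagators, (3.37) p.396, (3.50) p.400, Cor. 3.6 p.408] -/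
theorem norm_covDstar_tauB_cutA_le {χ : S → ℝ} {A : ι → S → 𝔸} {Q : Set S} {a b g η : ℝ} (ha : 0 ≤ a) (hb : 0 ≤ b) (hg : 0 ≤ g)
    (hχ1 : ∀ x, |χ x| ≤ 1) (hχg : ∀ μ x, |χ (T μ x) - χ x| ≤ g) (hQ0 : ∀ x, χ x ≠ 0 → x ∈ Q) (hQ1 : ∀ μ x, χ (T μ x) ≠ 0 → x ∈ Q)
    (hA : ∀ κ, ∀ x ∈ Q, ‖A κ x‖ ≤ a) (hdA : ∀ μ ν, ∀ x ∈ Q, ‖((η : ℂ)⁻¹) • covD T (fun _ _ => (1 : 𝔸ˣ)) μ (A ν) x‖ ≤ b) (μ : ι) (x : S) :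
    ‖((η : ℂ)⁻¹) • covDstar T (fun _ _ => (1 : 𝔸ˣ)) μ (tauB T (fun _ _ => (1 : 𝔸ˣ)) μ (cutA χ A μ)) x‖ ≤ b + |η|⁻¹ * g * a := by
  have e : covDstar T (fun _ _ => (1 : 𝔸ˣ)) μ (tauB T (fun _ _ => (1 : 𝔸ˣ)) μ (cutA χ A μ)) x =
      -covD T (fun _ _ => (1 : 𝔸ˣ)) μ (cutA χ A μ) ((T μ).symm ((T μ).symm x)) := by
    rw [covDstar_one_apply, tauB_one_apply, tauB_one_apply, covD_one_apply, Equiv.apply_symm_apply, neg_sub]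
  rw [e, smul_neg, norm_neg]
  exact norm_covD_cutA_le ha hb hg hχ1 hχg hQ0 hQ1 hA hdA μ μ _

/-- `|τ*_ν(χ·A)_κ| ≤ a`. [cite: Balaban1985BackgroundPropagators, (3.37) p.396, (3.50) p.400, Cor. 3.6 p.408] -/
theorem norm_tauB_cutA_le {χ : S → ℝ} {A : ι → S → 𝔸} {Q : Set S} {a : ℝ} (ha : 0 ≤ a) (hχ1 : ∀ x, |χ x| ≤ 1)
    (hQ0 : ∀ x, χ x ≠ 0 → x ∈ Q) (hA : ∀ κ, ∀ x ∈ Q, ‖A κ x‖ ≤ a) (ν κ : ι) (x : S) :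
    ‖tauB T (fun _ _ => (1 : 𝔸ˣ)) ν (cutA χ A κ) x‖ ≤ a := by
  rw [tauB_one_apply]; exact norm_cutA_le ha hχ1 hQ0 hA κ _

/-- single-scale to blockwise: `ξ⁻¹ ≤ Λ·len⁻¹` and `(ξ²)⁻¹ ≤ Λ²·(len²)⁻¹` when `0 < len ≤ Λξ`. [cite: Balaban1985BackgroundPropagators, Cor. 3.6 p.408 («α₁ = O(1)Mα₀»), bookkeeping] -/
theorem inv_scale_le {ξ Λ t : ℝ} (hξ : 0 < ξ) (ht : 0 < t) (htΛ : t ≤ Λ * ξ) :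
    ξ⁻¹ ≤ Λ * t⁻¹ ∧ (ξ ^ 2)⁻¹ ≤ Λ ^ 2 * (t ^ 2)⁻¹ := by
  have h0 : t * ξ⁻¹ ≤ Λ := by rwa [← div_eq_mul_inv, div_le_iff₀ hξ]
  have h1 : ξ⁻¹ ≤ Λ * t⁻¹ := by
    calc ξ⁻¹ = t⁻¹ * (t * ξ⁻¹) := by rw [← mul_assoc, inv_mul_cancel₀ ht.ne', one_mul]
      _ ≤ t⁻¹ * Λ := mul_le_mul_of_nonneg_left h0 (inv_nonneg.2 ht.le)
      _ = Λ * t⁻¹ := mul_comm _ _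
  refine ⟨h1, ?_⟩
  have h2 := pow_le_pow_left₀ (inv_nonneg.2 hξ.le) h1 2
  rw [inv_pow, mul_pow, inv_pow] at h2
  exact h2

/-- ★★ **THE FIVE (3.37)-READINGS OF `thm34_Gp_uniform` FOR `χ·A` AT THE BASE `1`, BLOCKWISE**: with the uniform bounds of `norm_cutA_le` ∕
`norm_covD_cutA_le` at the single scale `ξ` (`a = C·ξ⁻¹`, `b + |η|⁻¹g_χa ≤ C′·(ξ²)⁻¹`) and ANY length function `0 < len ≤ Λ·ξ` (`Λ ≥ 1`), the readings
`hA`, `hAτB` hold with `α₁·len⁻¹` and `h337F`, `h337B`, `h337Bτ` with `α₁·(len²)⁻¹`, `α₁ := max C C′ · Λ²` — Cor. 3.6's «α₁ = O(1)Mα₀» for the cube sequence,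
whose levels do not exceed the datum scale by more than `Λ ∈ {L, L²}`. [cite: Balaban1985BackgroundPropagators, Cor. 3.6 p.408, (3.37) p.396, Thm 3.4 p.400] -/
theorem readings337_cutA {χ : S → ℝ} {A : ι → S → 𝔸} {Q : Set S} {C C' g η ξ Λ : ℝ} (hC : 0 ≤ C) (hC' : 0 ≤ C') (hg : 0 ≤ g) (hξ : 0 < ξ) (hΛ : 1 ≤ Λ)
    (hχ1 : ∀ x, |χ x| ≤ 1) (hχg : ∀ μ x, |χ (T μ x) - χ x| ≤ g) (hQ0 : ∀ x, χ x ≠ 0 → x ∈ Q) (hQ1 : ∀ μ x, χ (T μ x) ≠ 0 → x ∈ Q)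
    (hA : ∀ κ, ∀ x ∈ Q, ‖A κ x‖ ≤ C * ξ⁻¹) (hdA : ∀ μ ν, ∀ x ∈ Q, ‖((η : ℂ)⁻¹) • covD T (fun _ _ => (1 : 𝔸ˣ)) μ (A ν) x‖ ≤ C * (ξ ^ 2)⁻¹)
    (hgξ : |η|⁻¹ * g * (C * ξ⁻¹) ≤ (C' - C) * (ξ ^ 2)⁻¹)
    (len : S → ℝ) (hlen : ∀ x, 0 < len x) (hlenΛ : ∀ x, len x ≤ Λ * ξ) :
    (∀ ν κ x, ‖((η : ℂ)⁻¹) • covDstar T (fun _ _ => (1 : 𝔸ˣ)) ν (cutA χ A κ) x‖ ≤ max C C' * Λ ^ 2 * (len x ^ 2)⁻¹) ∧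
    (∀ μ ν x, ‖((η : ℂ)⁻¹) • covD T (fun _ _ => (1 : 𝔸ˣ)) μ (cutA χ A ν) x‖ ≤ max C C' * Λ ^ 2 * (len x ^ 2)⁻¹) ∧
    (∀ μ x, ‖((η : ℂ)⁻¹) • covDstar T (fun _ _ => (1 : 𝔸ˣ)) μ (tauB T (fun _ _ => (1 : 𝔸ˣ)) μ (cutA χ A μ)) x‖ ≤ max C C' * Λ ^ 2 * (len x ^ 2)⁻¹) ∧
    (∀ κ x, ‖cutA χ A κ x‖ ≤ max C C' * Λ ^ 2 * (len x)⁻¹) ∧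
    (∀ ν κ x, ‖tauB T (fun _ _ => (1 : 𝔸ˣ)) ν (cutA χ A κ) x‖ ≤ max C C' * Λ ^ 2 * (len x)⁻¹) := by
  have ha : 0 ≤ C * ξ⁻¹ := mul_nonneg hC (inv_nonneg.2 hξ.le)
  have hb : 0 ≤ C * (ξ ^ 2)⁻¹ := mul_nonneg hC (inv_nonneg.2 (sq_nonneg ξ))
  have hΛ0 : 0 ≤ Λ := zero_le_one.trans hΛ
  have hΛ1 : Λ ≤ Λ ^ 2 := by nlinarith
  -- the uniform second-order bound `b + |η|⁻¹ g a ≤ C′(ξ²)⁻¹`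
  have h2 : C * (ξ ^ 2)⁻¹ + |η|⁻¹ * g * (C * ξ⁻¹) ≤ C' * (ξ ^ 2)⁻¹ := by linarith
  -- pointwise conversions
  have conv1 : ∀ x, C * ξ⁻¹ ≤ max C C' * Λ ^ 2 * (len x)⁻¹ := fun x => by
    obtain ⟨h1, -⟩ := inv_scale_le hξ (hlen x) (hlenΛ x)
    calc C * ξ⁻¹ ≤ C * (Λ * (len x)⁻¹) := mul_le_mul_of_nonneg_left h1 hC
      _ ≤ max C C' * (Λ ^ 2 * (len x)⁻¹) :=
          mul_le_mul (le_max_left _ _) (mul_le_mul_of_nonneg_right hΛ1 (inv_nonneg.2 (hlen x).le))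
            (mul_nonneg hΛ0 (inv_nonneg.2 (hlen x).le)) (hC.trans (le_max_left _ _))
      _ = max C C' * Λ ^ 2 * (len x)⁻¹ := by ring
  have conv2 : ∀ x, C' * (ξ ^ 2)⁻¹ ≤ max C C' * Λ ^ 2 * (len x ^ 2)⁻¹ := fun x => by
    obtain ⟨-, h1⟩ := inv_scale_le hξ (hlen x) (hlenΛ x)
    calc C' * (ξ ^ 2)⁻¹ ≤ C' * (Λ ^ 2 * (len x ^ 2)⁻¹) := mul_le_mul_of_nonneg_left h1 hC'
      _ ≤ max C C' * (Λ ^ 2 * (len x ^ 2)⁻¹) :=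
          mul_le_mul_of_nonneg_right (le_max_right _ _) (mul_nonneg (pow_nonneg hΛ0 2) (inv_nonneg.2 (sq_nonneg _)))
      _ = max C C' * Λ ^ 2 * (len x ^ 2)⁻¹ := by ring
  refine ⟨fun ν κ x => ?_, fun μ ν x => ?_, fun μ x => ?_, fun κ x => ?_, fun ν κ x => ?_⟩
  · exact ((norm_covDstar_cutA_le ha hb hg hχ1 hχg hQ0 hQ1 hA hdA ν κ x).trans h2).trans (conv2 x)
  · exact ((norm_covD_cutA_le ha hb hg hχ1 hχg hQ0 hQ1 hA hdA μ ν x).trans h2).trans (conv2 x)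
  · exact ((norm_covDstar_tauB_cutA_le ha hb hg hχ1 hχg hQ0 hQ1 hA hdA μ x).trans h2).trans (conv2 x)
  · exact (norm_cutA_le ha hχ1 hQ0 hA κ x).trans (conv1 x)
  · exact (norm_tauB_cutA_le ha hχ1 hQ0 hA ν κ x).trans (conv1 x)

end Generic

/-! ## §3  On def-Y's chart: the torus-side field `χ(chart x)·A`, the flat derivative through the chart, the readings from (3.35)-type bounds -/

section Chart

variable {𝔸 : Type} [NormedRing 𝔸] [NormedAlgebra ℂ 𝔸]
variable (i : KIdx d ℓ hd hL b₀ b₁)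

/-- **THE CUT-OFF EXPONENT FIELD ON THE TORUS**: `Ã_κ(x) = χ(chart x)·A_κ(x)` for a cut-off `χ` on def-Y's box chart and a torus-side exponent field `A`
(the (3.35) datum's); `Ṽ := e^{iηÃ}` is the (R)-design's localised configuration. [cite: Balaban1985BackgroundPropagators, Cor. 3.6 p.408 («U′ = U^u = e^{iηA}»), (3.35) p.396] -/
abbrev cutFldY (χ : SiteY i → ℝ) (A : AfldY 𝔸 i) : AfldY 𝔸 i := fun κ x => ((χ (boxEquiv i.hN x) : ℝ) : ℂ) • A κ x

/-- ON THE CHART the cut-off field is `cutA χ (chartA A)`. [cite: Balaban1985BackgroundPropagators, (3.37) p.396, bookkeeping] -/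
theorem chartA_cutFldY (χ : SiteY i → ℝ) (A : AfldY 𝔸 i) : chartA i (cutFldY i χ A) = cutA χ (chartA i A) := by
  funext κ z
  simp only [chartA_apply, cutA_apply, cutFldY, Equiv.apply_symm_apply]

/-- the base `1` read on the chart is the base `1`. [cite: Balaban1985BackgroundPropagators, Cor. 3.6 p.408 («with U = 1»), bookkeeping] -/
theorem UboxY_one [CompleteSpace 𝔸] : UboxY i (fun _ _ => (1 : 𝔸ˣ)) = fun _ _ => 1 := rfl

omit [NormedAlgebra ℂ 𝔸] in
/-- ★ **THE FLAT DERIVATIVE COMMUTES WITH THE CHART**: `D_{1,μ}(chartA A)_ν(z) = (D_{1,μ}A_ν)(chart⁻¹ z)` (torus shifts `shiftsV1`).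
[cite: Balaban1985BackgroundPropagators, (3.3) p.390, (3.35)∕(3.37) p.396 («∇^η» flat), dictionary] -/
theorem covD_one_chartA (μ ν : Fin (d + 1)) (A : AfldY 𝔸 i) (z : SiteY i) :
    covD (shiftY i) (fun _ _ => (1 : 𝔸ˣ)) μ (chartA i A ν) z =
      covD (shiftsV1 (PV d ℓ i.m i.K hd hL)) (fun _ _ => (1 : 𝔸ˣ)) μ (A ν) ((boxEquiv i.hN).symm z) := by
  rw [covD_one_apply, covD_one_apply, chartA_apply, chartA_apply, boxEquiv_symm_shiftY]
  rfl

/-- ★★ **THE FIVE (3.37)-READINGS OF `thm34_Gp_uniform` AT THE BASE `1` FOR THE CUT-OFF FIELD `chartA (χ·A)`, FROM (3.35)-TYPE BOUNDS OF `A` ON A TORUS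
SET `Q`** carrying `supp χ` and its backward translates (read through the chart), a cut-off `|χ| ≤ 1` with one-step variation `≤ g_χ`,
`|η|⁻¹g_χ·C·ξ⁻¹ ≤ (C′ − C)(ξ²)⁻¹`, and a length function `0 < len ≤ Λξ`: the hypotheses `h337B`, `h337F`, `h337Bτ`, `hA`, `hAτB` of
`B9Thm34SectBUniformR1.thm34_Gp_uniform` (with `T := shiftY i`, `U := 1`, `g.eta := η`, `g.len (blk x) := len x`) hold with `α₁ := max C C′·Λ²`.
[cite: Balaban1985BackgroundPropagators, Cor. 3.6 p.408 («U′ satisfies (3.37) … with U = 1 and α₁ = O(1)Mα₀»), (3.35)∕(3.37) p.396, Thm 3.4 p.400] -/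
theorem readings337_chartA_cutFldY {χ : SiteY i → ℝ} {A : AfldY 𝔸 i} {Q : Set (Site (PV d ℓ i.m i.K hd hL) 0)} {C C' g η ξ Λ : ℝ}
    (hC : 0 ≤ C) (hC' : 0 ≤ C') (hg : 0 ≤ g) (hξ : 0 < ξ) (hΛ : 1 ≤ Λ)
    (hχ1 : ∀ z, |χ z| ≤ 1) (hχg : ∀ μ z, |χ (shiftY i μ z) - χ z| ≤ g)
    (hQ0 : ∀ z, χ z ≠ 0 → (boxEquiv i.hN).symm z ∈ Q) (hQ1 : ∀ μ z, χ (shiftY i μ z) ≠ 0 → (boxEquiv i.hN).symm z ∈ Q)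
    (hA : ∀ κ, ∀ x ∈ Q, ‖A κ x‖ ≤ C * ξ⁻¹)
    (hdA : ∀ μ ν, ∀ x ∈ Q, ‖((η : ℂ)⁻¹) • covD (shiftsV1 (PV d ℓ i.m i.K hd hL)) (fun _ _ => (1 : 𝔸ˣ)) μ (A ν) x‖ ≤ C * (ξ ^ 2)⁻¹)
    (hgξ : |η|⁻¹ * g * (C * ξ⁻¹) ≤ (C' - C) * (ξ ^ 2)⁻¹)
    (len : SiteY i → ℝ) (hlen : ∀ z, 0 < len z) (hlenΛ : ∀ z, len z ≤ Λ * ξ) :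
    (∀ ν κ z, ‖((η : ℂ)⁻¹) • covDstar (shiftY i) (fun _ _ => (1 : 𝔸ˣ)) ν (chartA i (cutFldY i χ A) κ) z‖ ≤ max C C' * Λ ^ 2 * (len z ^ 2)⁻¹) ∧
    (∀ μ ν z, ‖((η : ℂ)⁻¹) • covD (shiftY i) (fun _ _ => (1 : 𝔸ˣ)) μ (chartA i (cutFldY i χ A) ν) z‖ ≤ max C C' * Λ ^ 2 * (len z ^ 2)⁻¹) ∧
    (∀ μ z, ‖((η : ℂ)⁻¹) • covDstar (shiftY i) (fun _ _ => (1 : 𝔸ˣ)) μ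
        (tauB (shiftY i) (fun _ _ => (1 : 𝔸ˣ)) μ (chartA i (cutFldY i χ A) μ)) z‖ ≤ max C C' * Λ ^ 2 * (len z ^ 2)⁻¹) ∧
    (∀ κ z, ‖chartA i (cutFldY i χ A) κ z‖ ≤ max C C' * Λ ^ 2 * (len z)⁻¹) ∧
    (∀ ν κ z, ‖tauB (shiftY i) (fun _ _ => (1 : 𝔸ˣ)) ν (chartA i (cutFldY i χ A) κ) z‖ ≤ max C C' * Λ ^ 2 * (len z)⁻¹) := by
  rw [chartA_cutFldY]
  refine readings337_cutA (Q := {z : SiteY i | (boxEquiv i.hN).symm z ∈ Q}) hC hC' hg hξ hΛ hχ1 hχg hQ0 hQ1 (fun κ z hz => ?_)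
    (fun μ ν z hz => ?_) hgξ len hlen hlenΛ
  · rw [chartA_apply]; exact hA κ _ hz
  · rw [covD_one_chartA]; exact hdA μ ν _ hz

end Chart

end Literature.MathematicalPhysics.QuantumFieldTheory.Balaban1983to89.B9Cor36CutoffField337

end
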